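import Summits.NavierStokesRegularity.NavierStokesRegularity.Theorems.PerpetualPumpThesisBesovDuhamelBound
import Summits.NavierStokesRegularity.NavierStokesRegularity.Theorems.PerpetualPumpThesisEnvelopeUpgradeDyadic
import Literature.Analysis.FunctionSpaces.LittlewoodPaleyInhomogeneousProofs
import Literature.Analysis.FluidPDE.CriticalRegularityProofs

/-!
# Stub K2 (`envelopeUpgrade`) for `PerpetualPump.Thesis`, part II: the blockwise census

Support file (part 2 of the stub `envelopeUpgrade` of line `SketchIdeator2`, crux
stmt-NavierStokesRegularity-1832). Let `u` be an `H¹⁰_df`-mild solution on `[0,T)` of the averaged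
Navier–Stokes equation of an arbitrary averaging datum `𝒜` (T. Tao, J. Amer. Math. Soc. 29 (2016),
(1.12)–(1.15)), write `N(s) = (T-s)^{-1/2}`, `b_k(s) = ‖Δ̇_k u(s)‖_{L^∞}` and
`X(s) = ‖u(s)‖_{Ḃ⁰_{∞,1}} = ∑_k b_k(s)`. This file supplies the blockwise ingredients of **the round
inequality of the census** (assembled in part III, `K2.exists_round_le`): there are constants `C_H, K`
of `𝒜` such that whenever

* `‖u(s)‖_{L^∞} ≤ M N(s)` on `[0,T)` (the `L^∞` Type-I rate, `M ≥ 0`), and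
* `X(s) ≤ A N(s)` on `[0,t]` for some `t < T` and `A ≥ 0` (a self-similar envelope majorant),

then `X(t') ≤ C_H X(0) + K M^{3/4} A^{1/2} N(t')` for every `t' ∈ [0,t]`. The gain `A ↦ A^{1/2}`
is what closes the envelope upgrade in part III. Ingredients (items 1–3 and the pointwise half of 4
are proved here, the summation over `k` in part III):

1. blockwise Duhamel bound with a time-dependent majorant (the blockwise estimate of stub F_A,
   `FA.exists_enorm_form_heat_test_le`, read through the test fields and the restarted Duhamel
   identity): `b_k(u(t') - e^{t'Δ}u(0)) ≤ 3K A² ∫_0^{t'} (T-s)^{-1} 2ᵏ e^{-(π²/8)(t'-s)4ᵏ} ds`;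
2. the singular time integral of part I with `θ = 1` and `θ = 1/4`: the Duhamel block is at most
   `C A² N min(x^{1/2}, x^{-1}) ≤ C A² N m_k⁴`, `x = 2ᵏ/N`, `m_k = min(x^{1/8}, x^{-1/8})`;
3. the a-priori cap `b_k(t') ≤ 2‖Ṡ‖ ‖u(t')‖_∞ ≤ a N`, `a = 2‖Ṡ‖ M` (blocks are bounded on `L^∞`);
4. the geometric mean `min(aN, C A² N m⁴) ≤ (aN)^{3/4} (C A² N m⁴)^{1/4} = a^{3/4} C^{1/4} A^{1/2} N m`
   and the anchored tent sum `∑_k m_k ≤ C_tent` of part I, uniform in the position of the front.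

## References

* T. Tao, J. Amer. Math. Soc. 29 (2016), 601–674, §1.1 (1.15).
* H. Bahouri, J.-Y. Chemin, R. Danchin, *Fourier Analysis and Nonlinear PDE* (2011), §2.1–2.2.
-/

noncomputable section

open MeasureTheory Filter Topology Set
open scoped SchwartzMap ENNReal NNReal

set_option linter.dupNamespace false

namespace Summit.NavierStokesRegularity.NavierStokesRegularity.Theorems.PerpetualPumpThesis.K2

open Literature.Analysis.FunctionSpaces Literature.Analysis.FluidPDE
  Literature.Analysis.FluidPDE.Tao2016

/-! ### Real-variable bookkeeping of the profile -/

/-- `((2^k)^2)^{1/4} = √(2^k)`. -/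
theorem rpow_quarter_sq_two_zpow (k : ℤ) :
    ((((2 : ℝ) ^ k) ^ 2) ^ (1 / 4 : ℝ)) = Real.sqrt ((2 : ℝ) ^ k) := by
  have h2 : 0 ≤ (2 : ℝ) ^ k := (zpow_pos two_pos k).le
  rw [← Real.rpow_natCast ((2 : ℝ) ^ k) 2, ← Real.rpow_mul h2, Real.sqrt_eq_rpow]
  norm_num

/-- `D^{-1/4} = (√(√D))⁻¹` for `D ≥ 0`. -/
theorem rpow_neg_quarter (D : ℝ) (hD : 0 ≤ D) :
    D ^ (-(1 / 4) : ℝ) = (Real.sqrt (Real.sqrt D))⁻¹ := by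
  rw [Real.rpow_neg hD, Real.sqrt_eq_rpow, Real.sqrt_eq_rpow, ← Real.rpow_mul hD]
  norm_num

/-- **The profile above the front (`θ = 1`)**: `(T-t)^{-1} 2ᵏ (κ4ᵏ)^{-1} Γ(1) = κ⁻¹ N x⁻¹` with
`N = (√D)⁻¹`, `x = 2ᵏ √D`, `D = T - t`. -/
theorem profile_one {D κ : ℝ} (hD : 0 < D) (hκ : 0 < κ) (k : ℤ) :
    D ^ (-(1 : ℝ)) * (2 : ℝ) ^ k * ((1 / (κ * ((2 : ℝ) ^ k) ^ 2)) ^ (1 : ℝ) * Real.Gamma 1) =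
      κ⁻¹ * ((Real.sqrt D)⁻¹ * ((2 : ℝ) ^ k * Real.sqrt D)⁻¹) := by
  have h2 : (2 : ℝ) ^ k ≠ 0 := (zpow_pos two_pos k).ne'
  rw [Real.rpow_one, Real.Gamma_one, Real.rpow_neg hD.le, Real.rpow_one]
  set s : ℝ := Real.sqrt D with hs_def
  have hs : s ≠ 0 := (Real.sqrt_pos.2 hD).ne'
  have hDs : D = s ^ 2 := (Real.sq_sqrt hD.le).symm
  rw [hDs]
  field_simp

/-- **The profile below the front (`θ = 1/4`)**:
`(T-t)^{-1/4} 2ᵏ (κ4ᵏ)^{-1/4} Γ(1/4) = Γ(1/4) κ^{-1/4} N √x`. -/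
theorem profile_quarter {D κ : ℝ} (hD : 0 < D) (hκ : 0 < κ) (k : ℤ) :
    D ^ (-(1 / 4 : ℝ)) * (2 : ℝ) ^ k *
        ((1 / (κ * ((2 : ℝ) ^ k) ^ 2)) ^ (1 / 4 : ℝ) * Real.Gamma (1 / 4)) =
      Real.Gamma (1 / 4) * κ ^ (-(1 / 4 : ℝ)) *
        ((Real.sqrt D)⁻¹ * Real.sqrt ((2 : ℝ) ^ k * Real.sqrt D)) := by
  have h2pos : 0 < (2 : ℝ) ^ k := zpow_pos two_pos k
  have hsD : 0 < Real.sqrt D := Real.sqrt_pos.2 hD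
  have hA : (1 / (κ * ((2 : ℝ) ^ k) ^ 2)) ^ (1 / 4 : ℝ) =
      κ ^ (-(1 / 4 : ℝ)) * (Real.sqrt ((2 : ℝ) ^ k))⁻¹ := by
    rw [one_div (κ * _), mul_inv, Real.mul_rpow (inv_nonneg.2 hκ.le) (inv_nonneg.2 (sq_nonneg _)),
      Real.inv_rpow hκ.le, ← Real.rpow_neg hκ.le, Real.inv_rpow (sq_nonneg _),
      rpow_quarter_sq_two_zpow]
  rw [hA, rpow_neg_quarter D hD.le, Real.sqrt_mul' _ hsD.le]
  set s2 : ℝ := Real.sqrt ((2 : ℝ) ^ k) with hs2_def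
  set s4 : ℝ := Real.sqrt (Real.sqrt D) with hs4_def
  have hs2 : s2 ≠ 0 := (Real.sqrt_pos.2 h2pos).ne'
  have hs4 : s4 ≠ 0 := (Real.sqrt_pos.2 hsD).ne'
  have h2k : (2 : ℝ) ^ k = s2 ^ 2 := (Real.sq_sqrt h2pos.le).symm
  have hsq : Real.sqrt D = s4 ^ 2 := (Real.sq_sqrt hsD.le).symm
  rw [h2k, hsq]
  field_simp

/-- **From the two profiles to the tent**: for `x > 0` and `m = min(x^{1/8}, x^{-1/8})`,
`min(√x, x⁻¹) ≤ m⁴`. -/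
theorem min_sqrt_inv_le_pow_four {x : ℝ} (hx : 0 < x) :
    min (Real.sqrt x) x⁻¹ ≤ (min (x ^ (1 / 8 : ℝ)) (x ^ (1 / 8 : ℝ))⁻¹) ^ 4 := by
  have hw4 : (x ^ (1 / 8 : ℝ)) ^ 4 = Real.sqrt x := by
    rw [← Real.rpow_natCast (x ^ (1 / 8 : ℝ)) 4, ← Real.rpow_mul hx.le, Real.sqrt_eq_rpow]
    norm_num
  rcases le_or_gt 1 x with h1 | h1
  · -- `x ≥ 1`: `m = x^{-1/8}`, `m⁴ = x^{-1/2} ≥ x⁻¹`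
    have hw1 : 1 ≤ x ^ (1 / 8 : ℝ) := Real.one_le_rpow h1 (by norm_num)
    rw [min_eq_right ((inv_le_one_of_one_le₀ hw1).trans hw1), inv_pow, hw4]
    refine (min_le_right _ _).trans ?_
    rw [inv_le_inv₀ hx (Real.sqrt_pos.2 hx)]
    calc Real.sqrt x ≤ Real.sqrt x * Real.sqrt x :=
          le_mul_of_one_le_right (Real.sqrt_nonneg x) (Real.one_le_sqrt.2 h1)
      _ = x := Real.mul_self_sqrt hx.le
  · -- `x < 1`: `m = x^{1/8}`, `m⁴ = √x`
    have hw1 : x ^ (1 / 8 : ℝ) ≤ 1 := Real.rpow_le_one hx.le h1.le (by norm_num)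
    have hwpos : 0 < x ^ (1 / 8 : ℝ) := Real.rpow_pos_of_pos hx _
    rw [min_eq_left (hw1.trans (one_le_inv_iff₀.2 ⟨hwpos, hw1⟩)), hw4]
    exact min_le_left _ _

/-- **The geometric mean of the cap and the profile**: for `a, c, N, m ≥ 0`,
`(aN)^{3/4} (c N m⁴)^{1/4} = a^{3/4} c^{1/4} N m`. -/
theorem gm_profile {a c N m : ℝ} (ha : 0 ≤ a) (hc : 0 ≤ c) (hN : 0 ≤ N) (hm : 0 ≤ m) :
    (a * N) ^ (3 / 4 : ℝ) * (c * N * m ^ 4) ^ (1 / 4 : ℝ) =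
      a ^ (3 / 4 : ℝ) * c ^ (1 / 4 : ℝ) * N * m := by
  have hm4 : (m ^ 4) ^ (1 / 4 : ℝ) = m := by
    rw [one_div]; exact Real.pow_rpow_inv_natCast hm four_ne_zero
  rw [Real.mul_rpow ha hN, Real.mul_rpow (mul_nonneg hc hN) (pow_nonneg hm 4),
    Real.mul_rpow hc hN, hm4]
  have hNN : N ^ (3 / 4 : ℝ) * N ^ (1 / 4 : ℝ) = N := by
    rw [← Real.rpow_add' hN (by norm_num)]; norm_num
  calc a ^ (3 / 4 : ℝ) * N ^ (3 / 4 : ℝ) * (c ^ (1 / 4 : ℝ) * N ^ (1 / 4 : ℝ) * m)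
      = a ^ (3 / 4 : ℝ) * c ^ (1 / 4 : ℝ) * (N ^ (3 / 4 : ℝ) * N ^ (1 / 4 : ℝ)) * m := by ring
    _ = a ^ (3 / 4 : ℝ) * c ^ (1 / 4 : ℝ) * N * m := by rw [hNN]

/-- `min p q ≤ p^{3/4} q^{1/4}` for `p, q ≥ 0`. -/
theorem min_le_rpow_mul_rpow {p q : ℝ} (hp : 0 ≤ p) (hq : 0 ≤ q) :
    min p q ≤ p ^ (3 / 4 : ℝ) * q ^ (1 / 4 : ℝ) := by
  have hm : 0 ≤ min p q := le_min hp hq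
  calc min p q = (min p q) ^ (3 / 4 : ℝ) * (min p q) ^ (1 / 4 : ℝ) := by
        rw [← Real.rpow_add' hm (by norm_num)]; norm_num
    _ ≤ p ^ (3 / 4 : ℝ) * q ^ (1 / 4 : ℝ) :=
        mul_le_mul (Real.rpow_le_rpow hm (min_le_left _ _) (by norm_num))
          (Real.rpow_le_rpow hm (min_le_right _ _) (by norm_num))
          (Real.rpow_nonneg hm _) (Real.rpow_nonneg hp _)

/-- **The tent variable**: `(2ᵏ √D)^{1/8} = (2^{1/8})ᵏ (√D)^{1/8}`. -/
theorem rpow_eighth_eq (k : ℤ) (D : ℝ) :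
    ((2 : ℝ) ^ k * Real.sqrt D) ^ (1 / 8 : ℝ) =
      ((2 : ℝ) ^ (1 / 8 : ℝ)) ^ k * (Real.sqrt D) ^ (1 / 8 : ℝ) := by
  rw [Real.mul_rpow (zpow_pos two_pos k).le (Real.sqrt_nonneg D)]
  congr 1
  rw [← Real.rpow_intCast (2 : ℝ) k, ← Real.rpow_mul zero_le_two, mul_comm,
    Real.rpow_mul zero_le_two, Real.rpow_intCast]

/-- `a + min b c ≥ d` bookkeeping in `ℝ≥0∞`: if `b ≤ p` and `b ≤ L + q` then `b ≤ L + min p q`. -/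
theorem le_add_min {b L p q : ℝ≥0∞} (h1 : b ≤ p) (h2 : b ≤ L + q) : b ≤ L + min p q := by
  rcases le_total p q with h | h
  · rw [min_eq_left h]; exact h1.trans le_add_self
  · rw [min_eq_right h]; exact h2


/-! ### Blockwise Duhamel bound with a time-dependent majorant -/

/-- **Blocks of the Duhamel term under a time-dependent envelope majorant.** For every averaging datum
there is `K < ∞` such that for every mild `H¹⁰_df` solution `u` on `[0,T)`, `0 ≤ t₁ ≤ t < T`, every
majorant `Φ` with `‖u(s)‖_{Ḃ⁰_{∞,1}} ≤ Φ(s)` on `[t₁,t]` and every `k ∈ ℤ`,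
`‖Δ̇_k(u(t) - e^{(t-t₁)Δ}u(t₁))‖_∞ ≤ 3 ∫_{t₁}^t K Φ(s)² 2ᵏ e^{-(π²/8)(t-s)4ᵏ} ds`
(the blockwise estimate `FA.exists_enorm_form_heat_test_le` of stub F_A read through the test
fields and the restarted Duhamel identity, with the majorant kept inside the time integral). -/
theorem exists_duhamel_block_majorant (𝒜 : AveragingDatum) :
    ∃ K : ℝ≥0∞, K ≠ ⊤ ∧ ∀ (a : L2C) (T : ℝ) (u : ℝ → L2C),
      IsMildSolutionFor 𝒜.form a (Ico 0 T) u → ∀ (Φ : ℝ → ℝ≥0∞) (t₁ t : ℝ), 0 ≤ t₁ → t₁ ≤ t → t < T →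
      (∀ s ∈ Icc t₁ t, eHomBesovNorm 0 ∞ 1
        ((u s : L2C) : 𝓢'(EuclideanSpace ℝ (Fin 3), EuclideanSpace ℂ (Fin 3))) ≤ Φ s) →
      ∀ k : ℤ, eLpNormDistrib ∞ (lpBlock k ((u t - heat (t - t₁) (u t₁) : L2C) :
          𝓢'(EuclideanSpace ℝ (Fin 3), EuclideanSpace ℂ (Fin 3)))) ≤
        3 * ∫⁻ s in Ioo t₁ t, K * Φ s ^ 2 *
          ENNReal.ofReal ((2 : ℝ) ^ k *
            Real.exp (-(Real.pi ^ 2 / 8) * ((t - s) * ((2 : ℝ) ^ k) ^ 2))) := by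
  obtain ⟨K, hKfin, hK⟩ := FA.exists_enorm_form_heat_test_le 𝒜
  refine ⟨K, hKfin, fun a T u hu Φ t₁ t ht₁ ht₁t htT hB k => ?_⟩
  have htI : t ∈ Ico 0 T := ⟨ht₁.trans ht₁t, htT⟩
  have ht₁I : t₁ ∈ Ico 0 T := ⟨ht₁, ht₁t.trans_lt htT⟩
  have hD : MemH10df (u t - heat (t - t₁) (u t₁)) := (hu.1 t htI).sub ((hu.1 t₁ ht₁I).heat _)
  refine FA.eLpNormDistrib_lpBlock_coe_le_of_pairing k _ hD.2.2 fun x i w hw hFw => ?_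
  have hpair : pairing (u t - heat (t - t₁) (u t₁)) w =
      ∫ s in t₁..t, 𝒜.form (u s) (u s) (heat (t - s) w) := by
    rw [pairing_sub_left, F.pairing_eq_restart 𝒜 hu ht₁ ht₁t htT hw]
    ring
  rw [hpair, intervalIntegral.integral_of_le ht₁t]
  refine (enorm_integral_le_lintegral_enorm _).trans ?_
  rw [← restrict_Ioo_eq_restrict_Ioc]
  refine setLIntegral_mono' measurableSet_Ioo fun s hs => ?_
  have hsI : s ∈ Ico 0 T := ⟨ht₁.trans hs.1.le, hs.2.trans htT⟩
  exact hK (u s) (hu.1 s hsI) _ (hB s ⟨hs.1.le, hs.2.le⟩) (t - s) (sub_nonneg.2 hs.2.le) k x i w hFw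

/-- **The Duhamel integral under the self-similar majorant `Φ(s) = A (T-s)^{-1/2}`**, for one
`θ ∈ (0,1]`: `3 ∫_{t₁}^{t} K Φ(s)² 2ᵏ e^{-(π²/8)(t-s)4ᵏ} ds ≤ 3 K A² (T-t)^{-θ} 2ᵏ ((π²/8)4ᵏ)^{-θ} Γ(θ)`
(part I). -/
theorem duhamel_integral_le_theta {K : ℝ≥0∞} (hKfin : K ≠ ⊤) {A T t : ℝ} (hA : 0 ≤ A) (htT : t < T)
    (t₁ : ℝ) (k : ℤ) {θ : ℝ} (hθ : 0 < θ) (hθ1 : θ ≤ 1) :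
    3 * ∫⁻ s in Ioo t₁ t, K * ENNReal.ofReal (A / Real.sqrt (T - s)) ^ 2 *
        ENNReal.ofReal ((2 : ℝ) ^ k * Real.exp (-(Real.pi ^ 2 / 8) * ((t - s) * ((2 : ℝ) ^ k) ^ 2))) ≤
      3 * K * ENNReal.ofReal (A ^ 2) * ENNReal.ofReal ((T - t) ^ (-θ) * (2 : ℝ) ^ k *
        ((1 / (Real.pi ^ 2 / 8 * ((2 : ℝ) ^ k) ^ 2)) ^ θ * Real.Gamma θ)) := by
  have hpt : EqOn (fun s => K * ENNReal.ofReal (A / Real.sqrt (T - s)) ^ 2 *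
      ENNReal.ofReal ((2 : ℝ) ^ k * Real.exp (-(Real.pi ^ 2 / 8) * ((t - s) * ((2 : ℝ) ^ k) ^ 2))))
      (fun s => K * ENNReal.ofReal (A ^ 2) * (ENNReal.ofReal ((T - s)⁻¹) *
        ENNReal.ofReal ((2 : ℝ) ^ k * Real.exp (-(Real.pi ^ 2 / 8) * ((t - s) * ((2 : ℝ) ^ k) ^ 2)))))
      (Ioo t₁ t) := by
    intro s hs
    have hTs : 0 < T - s := by linarith [hs.2]
    have hsq : ENNReal.ofReal (A / Real.sqrt (T - s)) ^ 2 =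
        ENNReal.ofReal (A ^ 2) * ENNReal.ofReal ((T - s)⁻¹) := by
      rw [← ENNReal.ofReal_pow (div_nonneg hA (Real.sqrt_nonneg _)), div_pow,
        Real.sq_sqrt hTs.le, div_eq_mul_inv, ENNReal.ofReal_mul (sq_nonneg A)]
    simp only [hsq]
    ring
  have hne : K * ENNReal.ofReal (A ^ 2) ≠ ⊤ := ENNReal.mul_ne_top hKfin ENNReal.ofReal_ne_top
  rw [setLIntegral_congr_fun measurableSet_Ioo hpt, lintegral_const_mul' _ _ hne]
  calc 3 * (K * ENNReal.ofReal (A ^ 2) * ∫⁻ s in Ioo t₁ t, ENNReal.ofReal ((T - s)⁻¹) *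
        ENNReal.ofReal ((2 : ℝ) ^ k * Real.exp (-(Real.pi ^ 2 / 8) * ((t - s) * ((2 : ℝ) ^ k) ^ 2))))
      ≤ 3 * (K * ENNReal.ofReal (A ^ 2) * ENNReal.ofReal ((T - t) ^ (-θ) * (2 : ℝ) ^ k *
          ((1 / (Real.pi ^ 2 / 8 * ((2 : ℝ) ^ k) ^ 2)) ^ θ * Real.Gamma θ))) := by
        gcongr
        exact lintegral_inv_mul_dyadicHeat_le hθ hθ1 (by positivity) htT t₁ k
    _ = _ := by ring

/-- **The Duhamel integral under the self-similar majorant is below the tent profile**: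
with `D = T - t`, `N = (√D)⁻¹`, `x = 2ᵏ √D`, `m = min(x^{1/8}, x^{-1/8})` and
`C_Γ = max((π²/8)⁻¹, Γ(1/4) (π²/8)^{-1/4})`,
`3 ∫_{t₁}^{t} K Φ(s)² 2ᵏ e^{-(π²/8)(t-s)4ᵏ} ds ≤ 3 K A² C_Γ N m⁴`. -/
theorem duhamel_integral_le_tent {K : ℝ≥0∞} (hKfin : K ≠ ⊤) {A T t : ℝ} (hA : 0 ≤ A) (htT : t < T)
    (t₁ : ℝ) (k : ℤ) :
    3 * ∫⁻ s in Ioo t₁ t, K * ENNReal.ofReal (A / Real.sqrt (T - s)) ^ 2 *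
        ENNReal.ofReal ((2 : ℝ) ^ k * Real.exp (-(Real.pi ^ 2 / 8) * ((t - s) * ((2 : ℝ) ^ k) ^ 2))) ≤
      ENNReal.ofReal (3 * K.toReal * A ^ 2 *
        max (Real.pi ^ 2 / 8)⁻¹ (Real.Gamma (1 / 4) * (Real.pi ^ 2 / 8) ^ (-(1 / 4 : ℝ))) *
        ((Real.sqrt (T - t))⁻¹ *
          (min (((2 : ℝ) ^ k * Real.sqrt (T - t)) ^ (1 / 8 : ℝ))
            (((2 : ℝ) ^ k * Real.sqrt (T - t)) ^ (1 / 8 : ℝ))⁻¹) ^ 4)) := by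
  set D : ℝ := T - t with hD
  have hDpos : 0 < D := sub_pos.2 htT
  have hκ : 0 < Real.pi ^ 2 / 8 := by positivity
  have hx : 0 < (2 : ℝ) ^ k * Real.sqrt D := mul_pos (zpow_pos two_pos k) (Real.sqrt_pos.2 hDpos)
  set CΓ : ℝ := max (Real.pi ^ 2 / 8)⁻¹ (Real.Gamma (1 / 4) * (Real.pi ^ 2 / 8) ^ (-(1 / 4 : ℝ)))
    with hCΓ
  have hK3 : 3 * K * ENNReal.ofReal (A ^ 2) = ENNReal.ofReal (3 * K.toReal * A ^ 2) := by
    rw [ENNReal.ofReal_mul (by positivity), ENNReal.ofReal_mul (by norm_num),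
      ENNReal.ofReal_toReal hKfin, ENNReal.ofReal_ofNat]
  have hc0 : 0 ≤ 3 * K.toReal * A ^ 2 := by positivity
  -- above the front, `θ = 1`
  have h1 := duhamel_integral_le_theta hKfin hA htT t₁ k one_pos le_rfl
  rw [hK3, profile_one hDpos hκ k, ← ENNReal.ofReal_mul hc0] at h1
  -- below the front, `θ = 1/4`
  have h4 := duhamel_integral_le_theta hKfin hA htT t₁ k (θ := 1 / 4) (by norm_num) (by norm_num)
  rw [hK3, profile_quarter hDpos hκ k, ← ENNReal.ofReal_mul hc0] at h4
  -- combine into the tent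
  have hCΓ0 : 0 ≤ CΓ := le_max_of_le_left (inv_nonneg.2 hκ.le)
  have hN : 0 ≤ (Real.sqrt D)⁻¹ := inv_nonneg.2 (Real.sqrt_nonneg D)
  have hmin : min (((2 : ℝ) ^ k * Real.sqrt D)⁻¹) (Real.sqrt ((2 : ℝ) ^ k * Real.sqrt D)) ≤
      (min (((2 : ℝ) ^ k * Real.sqrt D) ^ (1 / 8 : ℝ))
        (((2 : ℝ) ^ k * Real.sqrt D) ^ (1 / 8 : ℝ))⁻¹) ^ 4 := by
    rw [min_comm]
    exact min_sqrt_inv_le_pow_four hx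
  refine (le_min h1 h4).trans ?_
  rw [← ENNReal.ofReal_mono.map_min]
  refine ENNReal.ofReal_le_ofReal ?_
  rcases le_total (((2 : ℝ) ^ k * Real.sqrt D)⁻¹) (Real.sqrt ((2 : ℝ) ^ k * Real.sqrt D)) with h | h
  · rw [min_eq_left h] at hmin
    refine (min_le_left _ _).trans ?_
    calc 3 * K.toReal * A ^ 2 * ((Real.pi ^ 2 / 8)⁻¹ * ((Real.sqrt D)⁻¹ * ((2 : ℝ) ^ k * Real.sqrt D)⁻¹))
        ≤ 3 * K.toReal * A ^ 2 * (CΓ * ((Real.sqrt D)⁻¹ *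
            (min (((2 : ℝ) ^ k * Real.sqrt D) ^ (1 / 8 : ℝ))
              (((2 : ℝ) ^ k * Real.sqrt D) ^ (1 / 8 : ℝ))⁻¹) ^ 4)) := by
          gcongr
          exact le_max_left _ _
      _ = _ := by ring
  · rw [min_eq_right h] at hmin
    refine (min_le_right _ _).trans ?_
    calc 3 * K.toReal * A ^ 2 * (Real.Gamma (1 / 4) * (Real.pi ^ 2 / 8) ^ (-(1 / 4 : ℝ)) *
          ((Real.sqrt D)⁻¹ * Real.sqrt ((2 : ℝ) ^ k * Real.sqrt D)))
        ≤ 3 * K.toReal * A ^ 2 * (CΓ * ((Real.sqrt D)⁻¹ *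
            (min (((2 : ℝ) ^ k * Real.sqrt D) ^ (1 / 8 : ℝ))
              (((2 : ℝ) ^ k * Real.sqrt D) ^ (1 / 8 : ℝ))⁻¹) ^ 4)) := by
          gcongr
          exact le_max_right _ _
      _ = _ := by ring

/-! ### The a-priori cap and the round inequality -/

/-- **Blocks are capped by the `L^∞` norm**: `‖Δ̇_k f‖_{L^∞} ≤ 2‖Ṡ‖ ‖f‖_{L^∞}` for `f ∈ L²(ℝ³; ℂ³)`. -/
theorem block_le_eLpNorm (f : L2C) (k : ℤ) :
    eLpNormDistrib ∞ (lpBlock k ((f : L2C) : 𝓢'(EuclideanSpace ℝ (Fin 3), EuclideanSpace ℂ (Fin 3)))) ≤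
      2 * lowFreqOpNormBound (EuclideanSpace ℝ (Fin 3)) *
        eLpNorm (f : EuclideanSpace ℝ (Fin 3) → EuclideanSpace ℂ (Fin 3)) ⊤ volume := by
  rw [← F.eLpNormDistrib_coe_two_eq_eLpNorm]
  exact eLpNormDistrib_lpBlock_le_two_mul k _

end Summit.NavierStokesRegularity.NavierStokesRegularity.Theorems.PerpetualPumpThesis.K2

namespace Summit.NavierStokesRegularity.NavierStokesRegularity.Theorems.PerpetualPumpThesis

open Literature.Analysis.FunctionSpaces Literature.Analysis.FluidPDE
  Literature.Analysis.FluidPDE.Tao2016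

/-- **Part Block of stub K2 `envelopeUpgrade` (registered sub-goal `stub_K2_Duhamel`)**: the blocks
of the Duhamel term of a mild `H¹⁰_df` solution of the averaged equation of any averaging datum under a
time-dependent envelope majorant `Φ`,
`‖Δ̇_k(u(t) - e^{(t-t₁)Δ}u(t₁))‖_∞ ≤ 3 ∫_{t₁}^t K Φ(s)² 2ᵏ e^{-(π²/8)(t-s)4ᵏ} ds`. -/
theorem stub_K2_Duhamel : ∀ 𝒜 : AveragingDatum, ∃ K : ENNReal, K ≠ ⊤ ∧ ∀ (a : L2C) (T : ℝ) (u : ℝ → L2C), IsMildSolutionFor 𝒜.form a (Ico 0 T) u → ∀ (Φ : ℝ → ENNReal) (t₁ t : ℝ), 0 ≤ t₁ → t₁ ≤ t → t < T → (∀ s ∈ Icc t₁ t, eHomBesovNorm 0 ⊤ 1 ((u s : L2C) : 𝓢'(EuclideanSpace ℝ (Fin 3), EuclideanSpace ℂ (Fin 3))) ≤ Φ s) → ∀ k : ℤ, eLpNormDistrib ⊤ (lpBlock k ((u t - heat (t - t₁) (u t₁) : L2C) : 𝓢'(EuclideanSpace ℝ (Fin 3), EuclideanSpace ℂ (Fin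 3)))) ≤ 3 * ∫⁻ s in Ioo t₁ t, K * Φ s ^ 2 * ENNReal.ofReal ((2 : ℝ) ^ k * Real.exp (-(Real.pi ^ 2 / 8) * ((t - s) * ((2 : ℝ) ^ k) ^ 2))) :=
  fun 𝒜 => K2.exists_duhamel_block_majorant 𝒜

end Summit.NavierStokesRegularity.NavierStokesRegularity.Theorems.PerpetualPumpThesis

end
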